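import Literature.Probability.RandomPlanarGeometry.BDGS2012CountMonoOps
import HarnessLib

/-!
# Monotonicity `cₙ ≤ cₙ₊₁` (O'Brien 1990): the extension identity and the trapped-walk criterion

Sibling file of `Literature.Probability.RandomPlanarGeometry.BDGS2012` (named fact
`BDGS2012_count_mono`, O'Brien, *Monotonicity of the number of self-avoiding walks*, J. Stat.
Phys. **59** (1990) 969–979, quoted in BDGS 2012 §1.3) on top of the vertex-function model
`saws d n` of `SAWCount.lean` and the operations file `BDGS2012CountMonoOps.lean`.

An `(n+1)`-step self-avoiding walk is an `n`-step self-avoiding walk followed by a step to a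
site which is adjacent to its endpoint and not yet visited (Madras–Slade §1.1: this is the
decomposition behind `cₙ₊₁ ≤ (2d-1)cₙ`, eq. (1.1.1)). Writing `extCount ω n` for the number of such
"free extensions" of `ω`, this gives the **extension identity**
`cₙ₊₁ = Σ_{ω ∈ saws d n} extCount ω n` (`count_succ_eq_sum_ext`), and hence the elementary
reformulations of O'Brien's theorem used by the injective approaches:

* `count_le_count_succ_of_fiber_card_le` — if the trapped `n`-step walks (`extCount = 0`) can be
  sent into `saws d n` so that every walk `ω'` receives at most `extCount ω' n - 1` of them, then
  `cₙ ≤ cₙ₊₁`;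
* `count_le_count_succ_of_trapped_injOn` — in particular an injection of the trapped `n`-step
  walks into the `n`-step walks with at least two free extensions gives `cₙ ≤ cₙ₊₁`.

[cite: MadrasSlade1993, §1.1, eq. (1.1.1)] [cite: BDGS2012, §1.3]
-/

noncomputable section

open Literature.Probability.LatticeModels Literature.Probability.Percolation SimpleGraph
open scoped BigOperators

namespace Literature.Probability.RandomPlanarGeometry.SAW.Zd

variable {d : ℕ}

/-! ### Unit steps and neighbours in `ℤ^d` -/

/-- The `2d` unit steps `±eₖ` of `ℤ^d`. [cite: MadrasSlade1993, §1.1] -/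
def unitSteps (d : ℕ) : Finset (Site d) :=
  (Finset.univ : Finset (Fin d × Bool)).image
    fun kb => if kb.2 then Pi.single kb.1 1 else -Pi.single kb.1 1

/-- Membership in `unitSteps`. [folklore] -/
theorem mem_unitSteps {v : Site d} :
    v ∈ unitSteps d ↔ ∃ k : Fin d, v = Pi.single k 1 ∨ v = -Pi.single k 1 := by
  simp only [unitSteps, Finset.mem_image, Finset.mem_univ, true_and, Prod.exists]
  constructor
  · rintro ⟨k, b, rfl⟩
    cases b
    · exact ⟨k, Or.inr (by simp)⟩
    · exact ⟨k, Or.inl (by simp)⟩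
  · rintro ⟨k, h | h⟩
    · exact ⟨k, true, by simp [h]⟩
    · exact ⟨k, false, by simp [h]⟩

/-- The lattice neighbours of a site, as a `Finset` (the same finset as
`Literature.Probability.LatticeModels.RCC.nbrs` of the contour files, which is carved out of the
`★`-ball; it is rebuilt here from the unit steps so that the self-avoiding-walk files do not
import the Pirogov–Sinai contour set-up). [cite: MadrasSlade1993, §1.1] -/
def nbrs (x : Site d) : Finset (Site d) :=
  (unitSteps d).image fun v => x + v

/-- `nbrs x` is exactly the set of sites adjacent to `x` in `zdGraph d`. [folklore] -/
theorem mem_nbrs {x y : Site d} : y ∈ nbrs x ↔ (zdGraph d).Adj x y := by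
  rw [nbrs, Finset.mem_image, zdGraph_adj_iff]
  constructor
  · rintro ⟨v, hv, rfl⟩
    obtain ⟨k, rfl | rfl⟩ := mem_unitSteps.1 hv
    · exact ⟨k, Or.inl rfl⟩
    · exact ⟨k, Or.inr (by simp)⟩
  · rintro ⟨k, h | h⟩
    · exact ⟨Pi.single k 1, mem_unitSteps.2 ⟨k, Or.inl rfl⟩, h.symm⟩
    · refine ⟨-Pi.single k 1, mem_unitSteps.2 ⟨k, Or.inr rfl⟩, ?_⟩
      rw [h]; abel

/-! ### Free extensions of a walk -/

/-- The sites visited by `ω` during `[0, n]`. [folklore] -/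
def visited (ω : ℕ → Site d) (n : ℕ) : Finset (Site d) :=
  (Finset.range (n + 1)).image ω

/-- Membership in `visited`. [folklore] -/
theorem mem_visited {ω : ℕ → Site d} {n : ℕ} {y : Site d} :
    y ∈ visited ω n ↔ ∃ i ≤ n, ω i = y := by
  simp only [visited, Finset.mem_image, Finset.mem_range, Nat.lt_succ_iff]

open Classical in
/-- The **free extensions** of `ω` at time `n`: the neighbours of `ω n` not visited during
`[0, n]` (the sites by which the walk can be prolonged by one step). [cite: MadrasSlade1993, §1.1] -/
def freeNbrs (ω : ℕ → Site d) (n : ℕ) : Finset (Site d) :=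
  (nbrs (ω n)).filter fun y => y ∉ visited ω n

/-- Membership in `freeNbrs`. [folklore] -/
theorem mem_freeNbrs {ω : ℕ → Site d} {n : ℕ} {y : Site d} :
    y ∈ freeNbrs ω n ↔ (zdGraph d).Adj (ω n) y ∧ ∀ i ≤ n, ω i ≠ y := by
  classical
  simp only [freeNbrs, Finset.mem_filter, mem_nbrs, mem_visited, not_exists, not_and]

/-- `extCount ω n`: the number of free extensions of `ω` at time `n` (the walk is *trapped* when
`extCount ω n = 0`). [cite: MadrasSlade1993, §1.1] -/
def extCount (ω : ℕ → Site d) (n : ℕ) : ℕ := (freeNbrs ω n).card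

/-- `freeNbrs ω n` depends only on `ω` restricted to `[0, n]`. [folklore] -/
theorem freeNbrs_congr {ω₁ ω₂ : ℕ → Site d} {n : ℕ} (h : ∀ i ≤ n, ω₁ i = ω₂ i) :
    freeNbrs ω₁ n = freeNbrs ω₂ n := by
  ext y
  simp only [mem_freeNbrs, h n le_rfl]
  constructor
  · rintro ⟨ha, hne⟩; exact ⟨ha, fun i hi => h i hi ▸ hne i hi⟩
  · rintro ⟨ha, hne⟩; exact ⟨ha, fun i hi => (h i hi).symm ▸ hne i hi⟩

/-! ### Extending and restricting walks -/

/-- The walk `ω` up to time `n`, then frozen at the site `y`. [folklore] -/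
def extendTo (ω : ℕ → Site d) (n : ℕ) (y : Site d) : ℕ → Site d :=
  fun i => if i ≤ n then ω i else y

/-- The walk `ω` up to time `n`, frozen afterwards. [folklore] -/
def restrictTo (ω : ℕ → Site d) (n : ℕ) : ℕ → Site d :=
  fun i => ω (min i n)

/-- Before the cut time the extension is the walk. [folklore] -/
theorem extendTo_of_le {ω : ℕ → Site d} {n : ℕ} {y : Site d} {i : ℕ} (h : i ≤ n) :
    extendTo ω n y i = ω i := if_pos h

/-- After the cut time the extension is frozen at the new site. [folklore] -/
theorem extendTo_of_lt {ω : ℕ → Site d} {n : ℕ} {y : Site d} {i : ℕ} (h : n < i) :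
    extendTo ω n y i = y := if_neg (not_le.2 h)

/-- Unfolding `restrictTo`. [folklore] -/
@[simp] theorem restrictTo_apply (ω : ℕ → Site d) (n i : ℕ) : restrictTo ω n i = ω (min i n) := rfl

/-- Extending an `n`-step self-avoiding walk by a free extension gives an `(n+1)`-step
self-avoiding walk. [cite: MadrasSlade1993, §1.1] -/
theorem extendTo_mem_saws {n : ℕ} {ω : ℕ → Site d} {y : Site d} (hω : ω ∈ saws d n)
    (hy : y ∈ freeNbrs ω n) : extendTo ω n y ∈ saws d (n + 1) := by
  obtain ⟨h0, hend, hadj, hinj⟩ := mem_saws.1 hω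
  obtain ⟨hya, hyn⟩ := mem_freeNbrs.1 hy
  refine mem_saws.2 ⟨?_, ?_, ?_, ?_⟩
  · rw [extendTo_of_le (Nat.zero_le n), h0]
  · intro i hi
    rw [extendTo_of_lt (by omega), extendTo_of_lt (by omega)]
  · intro i hi
    rcases Nat.lt_or_ge i n with h | h
    · rw [extendTo_of_le h.le, extendTo_of_le (by omega)]
      exact hadj i h
    · have : i = n := by omega
      subst this
      rw [extendTo_of_le le_rfl, extendTo_of_lt (Nat.lt_succ_self i)]
      exact hya
  · intro i hi j hj hij
    simp only [Set.mem_setOf_eq] at hi hj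
    rcases Nat.lt_or_ge n i with hin | hin <;> rcases Nat.lt_or_ge n j with hjn | hjn
    · omega
    · exfalso
      rw [extendTo_of_lt hin, extendTo_of_le hjn] at hij
      exact hyn j hjn hij.symm
    · exfalso
      rw [extendTo_of_le hin, extendTo_of_lt hjn] at hij
      exact hyn i hin hij
    · rw [extendTo_of_le hin, extendTo_of_le hjn] at hij
      exact hinj (by simp only [Set.mem_setOf_eq]; omega) (by simp only [Set.mem_setOf_eq]; omega) hij

/-- Restricting an `(n+1)`-step self-avoiding walk to `[0, n]` gives an `n`-step one.
[cite: MadrasSlade1993, §1.1] -/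
theorem restrictTo_mem_saws {n : ℕ} {q : ℕ → Site d} (hq : q ∈ saws d (n + 1)) :
    restrictTo q n ∈ saws d n := by
  obtain ⟨h0, -, hadj, hinj⟩ := mem_saws.1 hq
  refine mem_saws.2 ⟨by simpa using h0, ?_, ?_, ?_⟩
  · intro i hi
    simp [min_eq_right hi]
  · intro i hi
    simp only [restrictTo_apply, min_eq_left hi.le, min_eq_left (Nat.succ_le_of_lt hi)]
    exact hadj i (by omega)
  · intro i hi j hj hij
    simp only [Set.mem_setOf_eq] at hi hj
    simp only [restrictTo_apply, min_eq_left hi, min_eq_left hj] at hij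
    exact hinj (by simp only [Set.mem_setOf_eq]; omega) (by simp only [Set.mem_setOf_eq]; omega) hij

/-- The last site of an `(n+1)`-step self-avoiding walk is a free extension of its restriction.
[cite: MadrasSlade1993, §1.1] -/
theorem apply_succ_mem_freeNbrs {n : ℕ} {q : ℕ → Site d} (hq : q ∈ saws d (n + 1)) :
    q (n + 1) ∈ freeNbrs (restrictTo q n) n := by
  obtain ⟨-, -, hadj, hinj⟩ := mem_saws.1 hq
  refine mem_freeNbrs.2 ⟨?_, ?_⟩
  · simpa using hadj n (Nat.lt_succ_self n)
  · intro i hi h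
    simp only [restrictTo_apply, min_eq_left hi] at h
    have := hinj (by simp only [Set.mem_setOf_eq]; omega) (by simp only [Set.mem_setOf_eq]; omega) h
    omega

/-- Restricting an extension recovers the walk (for a walk frozen from time `n`). [folklore] -/
theorem restrictTo_extendTo {n : ℕ} {ω : ℕ → Site d} (hω : ω ∈ saws d n) (y : Site d) :
    restrictTo (extendTo ω n y) n = ω := by
  funext i
  simp only [restrictTo_apply, extendTo_of_le (min_le_right i n)]
  rcases le_or_gt i n with h | h
  · rw [min_eq_left h]
  · rw [min_eq_right h.le, (mem_saws.1 hω).2.1 i h.le]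

/-- Extending the restriction by the last site recovers the walk. [folklore] -/
theorem extendTo_restrictTo {n : ℕ} {q : ℕ → Site d} (hq : q ∈ saws d (n + 1)) :
    extendTo (restrictTo q n) n (q (n + 1)) = q := by
  funext i
  rcases le_or_gt i n with h | h
  · rw [extendTo_of_le h, restrictTo_apply, min_eq_left h]
  · rw [extendTo_of_lt h, (mem_saws.1 hq).2.1 i (by omega)]

/-! ### The extension identity `cₙ₊₁ = Σ_ω extCount ω n` -/

open Classical in
/-- The fibre of the restriction map over `ω ∈ saws d n` is the set of one-step extensions of
`ω`, whose cardinality is `extCount ω n`. [cite: MadrasSlade1993, §1.1] -/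
theorem card_filter_restrictTo_eq {n : ℕ} {ω : ℕ → Site d} (hω : ω ∈ saws d n) :
    ((saws d (n + 1)).filter fun q => restrictTo q n = ω).card = extCount ω n := by
  classical
  rw [extCount]
  have himg : ((saws d (n + 1)).filter fun q => restrictTo q n = ω) =
      (freeNbrs ω n).image (extendTo ω n) := by
    ext q
    simp only [Finset.mem_filter, Finset.mem_image]
    constructor
    · rintro ⟨hq, hres⟩
      refine ⟨q (n + 1), ?_, ?_⟩
      · have := apply_succ_mem_freeNbrs hq
        rwa [hres] at this
      · rw [← hres, extendTo_restrictTo hq]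
    · rintro ⟨y, hy, rfl⟩
      exact ⟨extendTo_mem_saws hω hy, restrictTo_extendTo hω y⟩
  rw [himg, Finset.card_image_of_injOn]
  intro y₁ _ y₂ _ h
  have := congrFun h (n + 1)
  rwa [extendTo_of_lt (Nat.lt_succ_self n), extendTo_of_lt (Nat.lt_succ_self n)] at this

/-- **The extension identity**: `#saws d (n+1) = Σ_{ω ∈ saws d n} extCount ω n` — every
`(n+1)`-step self-avoiding walk is an `n`-step one followed by a free extension, uniquely.
[cite: MadrasSlade1993, §1.1, eq. (1.1.1)] -/
theorem card_saws_succ (d n : ℕ) : (saws d (n + 1)).card = ∑ ω ∈ saws d n, extCount ω n := by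
  classical
  rw [Finset.card_eq_sum_card_fiberwise (f := fun q => restrictTo q n) (t := saws d n)
    (fun q hq => Finset.mem_coe.2 (restrictTo_mem_saws (Finset.mem_coe.1 hq)))]
  exact Finset.sum_congr rfl fun ω hω => card_filter_restrictTo_eq hω

/-- **`cₙ₊₁ = Σ_{ω ∈ saws d n} extCount ω n`.** [cite: MadrasSlade1993, §1.1, eq. (1.1.1)] -/
theorem count_succ_eq_sum_ext (d n : ℕ) : count d (n + 1) = ∑ ω ∈ saws d n, extCount ω n := by
  rw [← card_saws, card_saws_succ]

/-! ### The trapped-walk criteria for `cₙ ≤ cₙ₊₁` -/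

open Classical in
/-- **Trapped-walk criterion (with multiplicities).** Suppose the trapped `n`-step walks
(`extCount ω n = 0`) are sent by `F` into `saws d n` in such a way that every walk `ω'` receives at
most `extCount ω' n - 1` of them. Then `cₙ ≤ cₙ₊₁`. (By the extension identity,
`cₙ₊₁ - cₙ = Σ_ω (extCount ω n - 1)`, and the hypothesis pays the deficit `1` of each trapped walk out
of the surplus `extCount ω' n - 1` of its image.) [cite: BDGS2012, §1.3] -/
theorem count_le_count_succ_of_fiber_card_le {n : ℕ} (F : (ℕ → Site d) → (ℕ → Site d))
    (hF : ∀ ω ∈ saws d n, extCount ω n = 0 → F ω ∈ saws d n)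
    (hfib : ∀ ω' ∈ saws d n,
      ((saws d n).filter fun ω => extCount ω n = 0 ∧ F ω = ω').card ≤ extCount ω' n - 1) :
    count d n ≤ count d (n + 1) := by
  classical
  set S := saws d n with hS
  set T := S.filter fun ω => extCount ω n = 0 with hT
  -- the trapped walks, counted through the fibres of `F`
  have hTsum : T.card = ∑ ω' ∈ S, (T.filter fun ω => F ω = ω').card :=
    Finset.card_eq_sum_card_fiberwise fun ω hω => by
      have hω' := Finset.mem_filter.1 (Finset.mem_coe.1 hω)
      exact Finset.mem_coe.2 (hF ω hω'.1 hω'.2)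
  have hfib' : ∀ ω' ∈ S, (T.filter fun ω => F ω = ω').card ≤ extCount ω' n - 1 := by
    intro ω' hω'
    have : (T.filter fun ω => F ω = ω') = S.filter fun ω => extCount ω n = 0 ∧ F ω = ω' := by
      rw [hT, Finset.filter_filter]
    rw [this]
    exact hfib ω' hω'
  -- pointwise: `[extCount ≥ 1] + #fibre ≤ extCount`
  have hpt : ∀ ω' ∈ S,
      (if extCount ω' n = 0 then 0 else 1) + (T.filter fun ω => F ω = ω').card ≤ extCount ω' n := by
    intro ω' hω'
    have h := hfib' ω' hω'
    split_ifs with h0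
    · rw [h0] at h ⊢; simpa using h
    · omega
  have hsplit : S.card = (S.filter fun ω => ¬ extCount ω n = 0).card + T.card := by
    rw [hT, add_comm]
    exact (Finset.card_filter_add_card_filter_not (s := S) (fun ω => extCount ω n = 0)).symm
  calc count d n = S.card := (card_saws d n).symm
    _ = (∑ ω' ∈ S, (if extCount ω' n = 0 then 0 else 1)) + T.card := by
        rw [hsplit, Finset.card_filter]
        congr 1
        exact Finset.sum_congr rfl fun ω _ => by split_ifs <;> rfl
    _ = ∑ ω' ∈ S, ((if extCount ω' n = 0 then 0 else 1) + (T.filter fun ω => F ω = ω').card) := by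
        rw [hTsum, Finset.sum_add_distrib]
    _ ≤ ∑ ω' ∈ S, extCount ω' n := Finset.sum_le_sum hpt
    _ = count d (n + 1) := (count_succ_eq_sum_ext d n).symm

open Classical in
/-- **Trapped-walk criterion (injective form).** An injection of the trapped `n`-step
self-avoiding walks into the `n`-step self-avoiding walks having at least two free extensions
yields `cₙ ≤ cₙ₊₁`. [cite: BDGS2012, §1.3] -/
theorem count_le_count_succ_of_trapped_injOn {n : ℕ} (F : (ℕ → Site d) → (ℕ → Site d))
    (hF : ∀ ω ∈ saws d n, extCount ω n = 0 → F ω ∈ saws d n ∧ 2 ≤ extCount (F ω) n)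
    (hinj : Set.InjOn F {ω | ω ∈ saws d n ∧ extCount ω n = 0}) :
    count d n ≤ count d (n + 1) := by
  classical
  refine count_le_count_succ_of_fiber_card_le F (fun ω hω h0 => (hF ω hω h0).1) ?_
  intro ω' hω'
  by_cases hne : ((saws d n).filter fun ω => extCount ω n = 0 ∧ F ω = ω').Nonempty
  · obtain ⟨ω₀, hω₀⟩ := hne
    rw [Finset.mem_filter] at hω₀
    have h2 : 2 ≤ extCount ω' n := hω₀.2.2 ▸ (hF ω₀ hω₀.1 hω₀.2.1).2
    have h1 : ((saws d n).filter fun ω => extCount ω n = 0 ∧ F ω = ω').card ≤ 1 := by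
      refine Finset.card_le_one.2 fun a ha b hb => ?_
      rw [Finset.mem_filter] at ha hb
      exact hinj ⟨ha.1, ha.2.1⟩ ⟨hb.1, hb.2.1⟩ (ha.2.2.trans hb.2.2.symm)
    omega
  · rw [Finset.not_nonempty_iff_eq_empty.1 hne, Finset.card_empty]
    exact Nat.zero_le _

/-- The named fact `BDGS2012_count_mono` (O'Brien 1990) follows from trapped-walk injections in
every dimension `d ≥ 1` and length `n`: it suffices to send, injectively, the trapped `n`-step
self-avoiding walks of `ℤ^d` to `n`-step self-avoiding walks with at least two free extensions.
[cite: BDGS2012, §1.3] -/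
theorem BDGS2012_count_mono_of_trapped_injections
    (h : ∀ d n : ℕ, 1 ≤ d → ∃ F : (ℕ → Site d) → (ℕ → Site d),
      (∀ ω ∈ saws d n, extCount ω n = 0 → F ω ∈ saws d n ∧ 2 ≤ extCount (F ω) n) ∧
      Set.InjOn F {ω | ω ∈ saws d n ∧ extCount ω n = 0}) :
    BDGS2012_count_mono := by
  intro d n hd
  obtain ⟨F, hF, hinj⟩ := h d n hd
  exact count_le_count_succ_of_trapped_injOn F hF hinj

end Literature.Probability.RandomPlanarGeometry.SAW.Zd
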